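import Mathlib
import HarnessLib
import Summits.Ventures.LatticeQCDFlow.Exactness.SphereFlowTransportCovariance

/-!
# The transport defect of Engel–Schaefer's leading-order trivializing flow: the residual of Lüscher's equation along `S̃⁽⁰⁾` is `−S₀ + s·(2κ²/(d−1))Σ_n‖p_n‖²`, and the tilted mean of a transported observable moves at the rate `s·Cov_s(H∘Φ_{c−s}, V₀)` — exact to first order in the flow time

HONEST FRAMING: exact (Metropolis-corrected) sampling algorithms for lattice gauge theory;
figures of merit are autocorrelation/cost numbers at stated couplings and volumes; no
continuum-physics claim.

Venture `LatticeQCDFlow` (cell pub-lqcd), topic `Exactness`; FANOUT row 7 (`s0-cpn-null`: the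
S0-D1 rung — 2D CP⁹, β ∈ [0.7, 1.0], Lüscher's LO trivializing map inside HMC, Engel–Schaefer
2011).  NEW WORK of the cell over the tree's `Exactness/SphereFlowTransport.lean` and
`Exactness/SphereFlowTransportCovariance.lean` (this leg: the transport identity and the covariance
law for the sphere gradient flow), `Exactness/SphereLOFlowAction.lean` (GEN-6: E–S eqs. (13), (15):
`∂̃_nS = −2κp_n`, `−Σ∂̃²S̃⁽⁰⁾ = S − S₀`), `Exactness/SphereNLOFlowAction.lean` (GEN-6:
`Σ_n⟪∂̃_nS, ∂̃_nS̃⁽⁰⁾⟫ = (2κ²/(d−1))Σ_n‖p_n‖²`), `Exactness/SphereGeodesicKick.lean`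
(`‖p‖² = ‖J‖² − ⟪J, x⟫²`)
and Mathlib; nothing is cited as a fact.  Printed counterpart, NAMED ONLY:
M. Lüscher, Commun. Math. Phys. 293 (2010) 899, §4.2–4.3 (the leading-order flow action and the
quality of truncated trivializing maps); Engel–Schaefer, Comput. Phys. Commun. 182 (2011) 2107, §3
eqs. (14)–(16) (the LO generator `T_n = (κ/(d−1))p_n` actually run by the rung).

For the lattice CP(N−1)/O(N) action `S = esAction κ S₀ U` (no self-coupling, adjoint pairs,
`d = dim E ≥ 2`) and ITS LEADING-ORDER FLOW `Φ` (the sphere gradient flow of `S̃⁽⁰⁾ = S/(2(d−1))`,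
`ẋ_n = T_n = (κ/(d−1))p_n`, which exists for all times — GEN-13):

* §1 **THE RESIDUAL OF LÜSCHER'S EQUATION ALONG THE LO ACTION**
  (**`sphereLuscherL_loFlowAction_sub_esAction`**): on `Ω`,
  `𝓛_sS̃⁽⁰⁾ − S = −S₀ + s·V₀`, `V₀ = Σ_n⟪∂̃_nS, ∂̃_nS̃⁽⁰⁾⟫ = (2κ²/(d−1))·Σ_n‖p_n‖²` (the tree's
  `sum_inner_siteGrad_esAction_loFlowAction`, GEN-6), with `0 ≤ V₀ ≤ (2κ²/(d−1))·Σ_n(Σ_m‖U_nm‖)²`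
  (**`loCarre_le`** — the residual grows at most linearly with the number of sites).
* §2 **THE LO TRANSPORT IDENTITY AND COVARIANCE LAW**
  (**`hasDerivAt_integral_exp_mul_comp_loFlow`**, **`hasDerivAt_tiltedMean_comp_loFlow`**):
  `(d/ds)∫e^{−sS}(H∘Φ_{c−s})dπ̄ = ∫e^{−sS}(H∘Φ_{c−s})(−S₀ + sV₀)dπ̄` and
  `(d/ds)⟨H∘Φ_{c−s}⟩_s = s·(⟨(H∘Φ_{c−s})V₀⟩_s − ⟨H∘Φ_{c−s}⟩_s⟨V₀⟩_s)` — the constant `−S₀` drops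
  out and THE LO MAP IS EXACT TO FIRST ORDER: the rate vanishes at `s = 0`.
* the sequel `Exactness/SphereLOMapSecondOrder.lean` integrates the covariance law:
  `|∫e^{−cS}H dπ̄/∫e^{−cS}dπ̄ − ∫H(Φ_c ω)dπ̄(ω)| ≤ (c²/2)·sup|H|·sup V₀ ≤ (c²/2)·sup|H|·(2κ²/(d−1))Σ_n(Σ_m‖U_nm‖)²`
  — the LO map is trivializing to second order with an explicit, volume-linear constant.

NOT CLAIMED: anything about the Euler-discretised map actually run by the rung (this is the exact
LO flow `Φ_c`; GEN-13 F3 relates one Euler step to it to first order); sharpness of the constant;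
the variance of the residual action (the quantity governing the acceptance rate) — only the bias of
uncorrected expectations is bounded here; NLO/NNLO maps (time-dependent generators, sequel);
anything about autocorrelations or the rung's numbers.
-/

noncomputable section

namespace Summit.Ventures.LatticeQCDFlow.Exactness

open Function Set Metric MeasureTheory NormedSpace InnerProductSpace
open scoped RealInnerProductSpace Topology

variable {Λ : Type*} {E : Type*} [NormedAddCommGroup E] [InnerProductSpace ℝ E]
  [FiniteDimensional ℝ E] [Fintype Λ] [DecidableEq Λ]

/-! ## §1 The residual of Lüscher's equation along the leading-order action -/

section Residual

variable {U : Λ → Λ → (E →L[ℝ] E)}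

/-- **THE RESIDUAL OF LÜSCHER'S EQUATION ALONG `S̃⁽⁰⁾`**: on `Ω̃`,
`𝓛_sS̃⁽⁰⁾(x) − S(x) = −S₀ + s·(2κ²/(d−1))·Σ_n‖p_n(x)‖²` — constant at `s = 0` (E–S eq. (15):
`S̃⁽⁰⁾` solves the leading-order equation exactly) and growing linearly in the flow time through the
carré du champ `V₀`. -/
theorem sphereLuscherL_loFlowAction_sub_esAction (hU0 : ∀ n, U n n = 0)
    (hUadj : ∀ m n (v w : E), ⟪U m n v, w⟫ = ⟪v, U n m w⟫) (hd : 2 ≤ Module.finrank ℝ E)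
    (κ S₀ s : ℝ) {x : Λ → E} (hx : ∀ n, ‖x n‖ = 1) :
    sphereLuscherL (esAction κ S₀ U) s (loFlowAction κ S₀ U) x - esAction κ S₀ U x =
      -S₀ + s * (2 * κ ^ 2 / ((Module.finrank ℝ E : ℝ) - 1) *
        ∑ n, ‖tangentKick (localField U n x) (x n)‖ ^ 2) := by
  rw [sphereLuscherL_apply, neg_sum_siteLaplacian_loFlowAction hU0 hUadj hd κ S₀ hx,
    sum_inner_siteGrad_esAction_loFlowAction hU0 hUadj hd κ S₀ hx]
  ring

omit [FiniteDimensional ℝ E] [DecidableEq Λ] in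
/-- `‖p_n‖ ≤ Σ_m ‖U_nm‖` on `Ω̃`: the tangential force is shorter than the local field, which is a
sum of unit vectors transported by the `U_nm`. -/
theorem norm_tangentKick_localField_le (U : Λ → Λ → (E →L[ℝ] E)) {x : Λ → E} (hx : ∀ n, ‖x n‖ = 1)
    (n : Λ) : ‖tangentKick (localField U n x) (x n)‖ ≤ ∑ m, ‖U n m‖ := by
  have h1 : ‖tangentKick (localField U n x) (x n)‖ ≤ ‖localField U n x‖ := by
    have hsq := norm_tangentKick_sq (localField U n x) (hx n)
    have : ‖tangentKick (localField U n x) (x n)‖ ^ 2 ≤ ‖localField U n x‖ ^ 2 := by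
      rw [hsq]; linarith [sq_nonneg ⟪localField U n x, x n⟫]
    exact (pow_le_pow_iff_left₀ (norm_nonneg _) (norm_nonneg _) two_ne_zero).1 this
  refine h1.trans ?_
  unfold localField
  refine (norm_sum_le _ _).trans (Finset.sum_le_sum fun m _ => ?_)
  calc ‖U n m (x m)‖ ≤ ‖U n m‖ * ‖x m‖ := (U n m).le_opNorm (x m)
    _ = ‖U n m‖ := by rw [hx m, mul_one]

omit [FiniteDimensional ℝ E] [DecidableEq Λ] in
/-- **`0 ≤ V₀ ≤ (2κ²/(d−1))·Σ_n(Σ_m‖U_nm‖)²` on `Ω̃`** (`d ≥ 2`): the residual's slope is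
nonnegative and grows at most linearly with the number of sites. -/
theorem loCarre_le (U : Λ → Λ → (E →L[ℝ] E)) (hd : 2 ≤ Module.finrank ℝ E) (κ : ℝ) {x : Λ → E}
    (hx : ∀ n, ‖x n‖ = 1) :
    0 ≤ 2 * κ ^ 2 / ((Module.finrank ℝ E : ℝ) - 1) * ∑ n, ‖tangentKick (localField U n x) (x n)‖ ^ 2 ∧
      2 * κ ^ 2 / ((Module.finrank ℝ E : ℝ) - 1) * ∑ n, ‖tangentKick (localField U n x) (x n)‖ ^ 2 ≤
        2 * κ ^ 2 / ((Module.finrank ℝ E : ℝ) - 1) * ∑ n, (∑ m, ‖U n m‖) ^ 2 := by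
  have hd' : 0 ≤ 2 * κ ^ 2 / ((Module.finrank ℝ E : ℝ) - 1) := by
    have : (2 : ℝ) ≤ Module.finrank ℝ E := by exact_mod_cast hd
    exact div_nonneg (by positivity) (by linarith)
  refine ⟨mul_nonneg hd' (Finset.sum_nonneg fun n _ => sq_nonneg _),
    mul_le_mul_of_nonneg_left (Finset.sum_le_sum fun n _ => ?_) hd'⟩
  exact pow_le_pow_left₀ (norm_nonneg _) (norm_tangentKick_localField_le U hx n) 2

omit [FiniteDimensional ℝ E] [DecidableEq Λ] in
/-- `ω ↦ Σ_n‖p_n(ω)‖²` is continuous on `Ω`. -/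
theorem continuous_sum_norm_tangentKick_sq_sphereConfig (U : Λ → Λ → (E →L[ℝ] E)) :
    Continuous fun ω : Λ → sphere (0 : E) 1 =>
      ∑ n, ‖tangentKick (localField U n (fun m => (ω m : E))) ((fun m => (ω m : E)) n)‖ ^ 2 := by
  refine continuous_finsetSum _ fun n _ => ?_
  have hJ : Continuous fun ω : Λ → sphere (0 : E) 1 => localField U n (fun m => (ω m : E)) :=
    (contDiff_localField U n (m := 0)).continuous.comp continuous_sphereConfig
  have hx : Continuous fun ω : Λ → sphere (0 : E) 1 => (fun m => (ω m : E)) n :=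
    (continuous_apply n).comp continuous_sphereConfig
  have h : Continuous fun ω : Λ → sphere (0 : E) 1 =>
      tangentKick (localField U n (fun m => (ω m : E))) ((fun m => (ω m : E)) n) := by
    unfold tangentKick
    exact hJ.sub ((hJ.inner hx).smul hx)
  exact (h.norm).pow 2

end Residual

/-! ## §2 The transport identity and the covariance law for the leading-order flow -/

section Transport

variable [MeasurableSpace E] [BorelSpace E] [Nontrivial E] {U : Λ → Λ → (E →L[ℝ] E)}

/-- **THE LO TRANSPORT IDENTITY**: along E–S's leading-order flow `Φ` (gradient flow of `S̃⁽⁰⁾`),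
`(d/ds)|_{s₀} ∫e^{−sS}H(Φ_{c−s}ω)dπ̄ = ∫e^{−s₀S}H(Φ_{c−s₀}ω)·(−S₀ + s₀·(2κ²/(d−1))Σ_n‖p_n(ω)‖²)dπ̄`
(`H ∈ C¹`, all real `c`, `s₀`; no self-coupling, adjoint pairs, `d ≥ 2`). -/
theorem hasDerivAt_integral_exp_mul_comp_loFlow (hU0 : ∀ n, U n n = 0)
    (hUadj : ∀ m n (v w : E), ⟪U m n v, w⟫ = ⟪v, U n m w⟫) (hd : 2 ≤ Module.finrank ℝ E)
    (κ S₀ : ℝ) {H : (Λ → E) → ℝ} (hH : ContDiff ℝ 1 H) (c s₀ : ℝ) :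
    HasDerivAt (fun s => ∫ ω,
        Real.exp (-(s * esAction κ S₀ U (fun m => ((ω : Λ → sphere (0 : E) 1) m : E)))) *
          H (sphereGradientFlow (contDiff_loFlowAction U κ S₀) (fun m => (ω m : E)) (c - s))
            ∂Measure.pi (fun _ : Λ => uniformSphere (volume : Measure E)))
      (∫ ω, Real.exp (-(s₀ * esAction κ S₀ U (fun m => ((ω : Λ → sphere (0 : E) 1) m : E)))) *
          H (sphereGradientFlow (contDiff_loFlowAction U κ S₀) (fun m => (ω m : E)) (c - s₀)) *
            (-S₀ + s₀ * (2 * κ ^ 2 / ((Module.finrank ℝ E : ℝ) - 1) *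
              ∑ n, ‖tangentKick (localField U n (fun m => (ω m : E))) ((fun m => (ω m : E)) n)‖ ^ 2))
        ∂Measure.pi (fun _ : Λ => uniformSphere (volume : Measure E))) s₀ := by
  have h := hasDerivAt_integral_exp_mul_comp_sphereGradientFlow (contDiff_esAction U κ S₀)
    (contDiff_loFlowAction U κ S₀) hH c s₀
  refine h.congr_deriv (integral_congr_ae (ae_of_all _ fun ω => ?_))
  dsimp only
  rw [sphereLuscherL_loFlowAction_sub_esAction hU0 hUadj hd κ S₀ s₀ (norm_sphereConfig_eq_one ω)]

/-- **THE LO COVARIANCE LAW**: `(d/ds)|_{s₀}⟨H∘Φ_{c−s}⟩_s =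
s₀·(⟨(H∘Φ_{c−s₀})·V₀⟩_{s₀} − ⟨H∘Φ_{c−s₀}⟩_{s₀}·⟨V₀⟩_{s₀})`, `V₀ = (2κ²/(d−1))Σ_n‖p_n‖²`,
`⟨·⟩_s = ∫e^{−sS}·dπ̄/∫e^{−sS}dπ̄` — the constant `−S₀` of the residual drops out of the covariance, so
THE LO MAP IS EXACT TO FIRST ORDER IN THE FLOW TIME (the rate vanishes at `s₀ = 0`). -/
theorem hasDerivAt_tiltedMean_comp_loFlow (hU0 : ∀ n, U n n = 0)
    (hUadj : ∀ m n (v w : E), ⟪U m n v, w⟫ = ⟪v, U n m w⟫) (hd : 2 ≤ Module.finrank ℝ E)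
    (κ S₀ : ℝ) {H : (Λ → E) → ℝ} (hH : ContDiff ℝ 1 H) (c s₀ : ℝ) :
    HasDerivAt (fun s =>
        (∫ ω, Real.exp (-(s * esAction κ S₀ U (fun m => ((ω : Λ → sphere (0 : E) 1) m : E)))) *
            H (sphereGradientFlow (contDiff_loFlowAction U κ S₀) (fun m => (ω m : E)) (c - s))
              ∂Measure.pi (fun _ : Λ => uniformSphere (volume : Measure E))) /
          ∫ ω, Real.exp (-(s * esAction κ S₀ U (fun m => ((ω : Λ → sphere (0 : E) 1) m : E))))
            ∂Measure.pi (fun _ : Λ => uniformSphere (volume : Measure E)))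
      (s₀ * ((∫ ω, Real.exp (-(s₀ * esAction κ S₀ U (fun m => ((ω : Λ → sphere (0 : E) 1) m : E)))) *
            H (sphereGradientFlow (contDiff_loFlowAction U κ S₀) (fun m => (ω m : E)) (c - s₀)) *
              (2 * κ ^ 2 / ((Module.finrank ℝ E : ℝ) - 1) *
                ∑ n, ‖tangentKick (localField U n (fun m => (ω m : E))) ((fun m => (ω m : E)) n)‖ ^ 2)
          ∂Measure.pi (fun _ : Λ => uniformSphere (volume : Measure E))) /
          (∫ ω, Real.exp (-(s₀ * esAction κ S₀ U (fun m => ((ω : Λ → sphere (0 : E) 1) m : E))))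
            ∂Measure.pi (fun _ : Λ => uniformSphere (volume : Measure E))) -
        (∫ ω, Real.exp (-(s₀ * esAction κ S₀ U (fun m => ((ω : Λ → sphere (0 : E) 1) m : E)))) *
            H (sphereGradientFlow (contDiff_loFlowAction U κ S₀) (fun m => (ω m : E)) (c - s₀))
          ∂Measure.pi (fun _ : Λ => uniformSphere (volume : Measure E))) /
          (∫ ω, Real.exp (-(s₀ * esAction κ S₀ U (fun m => ((ω : Λ → sphere (0 : E) 1) m : E))))
            ∂Measure.pi (fun _ : Λ => uniformSphere (volume : Measure E))) *
        ((∫ ω, Real.exp (-(s₀ * esAction κ S₀ U (fun m => ((ω : Λ → sphere (0 : E) 1) m : E)))) *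
              (2 * κ ^ 2 / ((Module.finrank ℝ E : ℝ) - 1) *
                ∑ n, ‖tangentKick (localField U n (fun m => (ω m : E))) ((fun m => (ω m : E)) n)‖ ^ 2)
            ∂Measure.pi (fun _ : Λ => uniformSphere (volume : Measure E))) /
          ∫ ω, Real.exp (-(s₀ * esAction κ S₀ U (fun m => ((ω : Λ → sphere (0 : E) 1) m : E))))
            ∂Measure.pi (fun _ : Λ => uniformSphere (volume : Measure E))))) s₀ := by
  have hS : ContDiff ℝ 1 (esAction κ S₀ U) := contDiff_esAction U κ S₀
  have hG : ContDiff ℝ 2 (loFlowAction κ S₀ U) := contDiff_loFlowAction U κ S₀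
  have h := hasDerivAt_tiltedMean_comp_sphereGradientFlow hS hG hH c s₀
  refine h.congr_deriv ?_
  have hZ := integral_exp_neg_mul_pos (Λ := Λ) (E := E) hS.continuous s₀
  -- rewrite the residual, then split the integrals
  have hres : ∀ ω : Λ → sphere (0 : E) 1,
      sphereLuscherL (esAction κ S₀ U) s₀ (loFlowAction κ S₀ U) (fun m => (ω m : E)) -
          esAction κ S₀ U (fun m => (ω m : E)) =
        -S₀ + s₀ * (2 * κ ^ 2 / ((Module.finrank ℝ E : ℝ) - 1) *
          ∑ n, ‖tangentKick (localField U n (fun m => (ω m : E))) ((fun m => (ω m : E)) n)‖ ^ 2) :=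
    fun ω => sphereLuscherL_loFlowAction_sub_esAction hU0 hUadj hd κ S₀ s₀ (norm_sphereConfig_eq_one ω)
  simp_rw [hres]
  have hcW := continuous_exp_neg_mul_sphereConfig (Λ := Λ) hS.continuous s₀
  have hcK : Continuous fun ω : Λ → sphere (0 : E) 1 =>
      H (sphereGradientFlow hG (fun m => (ω m : E)) (c - s₀)) :=
    (hH.continuous.comp (continuous_sphereGradientFlow hG (c - s₀))).comp continuous_sphereConfig
  have hcV : Continuous fun ω : Λ → sphere (0 : E) 1 =>
      2 * κ ^ 2 / ((Module.finrank ℝ E : ℝ) - 1) *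
        ∑ n, ‖tangentKick (localField U n (fun m => (ω m : E))) ((fun m => (ω m : E)) n)‖ ^ 2 :=
    continuous_const.mul (continuous_sum_norm_tangentKick_sq_sphereConfig U)
  have hiK : Integrable (fun ω : Λ → sphere (0 : E) 1 =>
      Real.exp (-(s₀ * esAction κ S₀ U (fun m => (ω m : E)))) *
        H (sphereGradientFlow hG (fun m => (ω m : E)) (c - s₀)))
      (Measure.pi fun _ : Λ => uniformSphere (volume : Measure E)) :=
    integrable_pi_of_continuous _ (hcW.mul hcK)
  have hiKV : Integrable (fun ω : Λ → sphere (0 : E) 1 =>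
      Real.exp (-(s₀ * esAction κ S₀ U (fun m => (ω m : E)))) *
        H (sphereGradientFlow hG (fun m => (ω m : E)) (c - s₀)) *
          (2 * κ ^ 2 / ((Module.finrank ℝ E : ℝ) - 1) *
            ∑ n, ‖tangentKick (localField U n (fun m => (ω m : E))) ((fun m => (ω m : E)) n)‖ ^ 2))
      (Measure.pi fun _ : Λ => uniformSphere (volume : Measure E)) :=
    integrable_pi_of_continuous _ ((hcW.mul hcK).mul hcV)
  have hiV : Integrable (fun ω : Λ → sphere (0 : E) 1 =>
      Real.exp (-(s₀ * esAction κ S₀ U (fun m => (ω m : E)))) *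
        (2 * κ ^ 2 / ((Module.finrank ℝ E : ℝ) - 1) *
          ∑ n, ‖tangentKick (localField U n (fun m => (ω m : E))) ((fun m => (ω m : E)) n)‖ ^ 2))
      (Measure.pi fun _ : Λ => uniformSphere (volume : Measure E)) :=
    integrable_pi_of_continuous _ (hcW.mul hcV)
  have hiW : Integrable (fun ω : Λ → sphere (0 : E) 1 =>
      Real.exp (-(s₀ * esAction κ S₀ U (fun m => (ω m : E)))))
      (Measure.pi fun _ : Λ => uniformSphere (volume : Measure E)) :=
    integrable_pi_of_continuous _ hcW
  -- split the two integrals containing the residual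
  have hKR : ∫ ω, Real.exp (-(s₀ * esAction κ S₀ U (fun m => ((ω : Λ → sphere (0 : E) 1) m : E)))) *
        H (sphereGradientFlow hG (fun m => (ω m : E)) (c - s₀)) *
          (-S₀ + s₀ * (2 * κ ^ 2 / ((Module.finrank ℝ E : ℝ) - 1) *
            ∑ n, ‖tangentKick (localField U n (fun m => (ω m : E))) ((fun m => (ω m : E)) n)‖ ^ 2))
        ∂Measure.pi (fun _ : Λ => uniformSphere (volume : Measure E)) =
      -S₀ * (∫ ω, Real.exp (-(s₀ * esAction κ S₀ U (fun m => ((ω : Λ → sphere (0 : E) 1) m : E)))) *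
          H (sphereGradientFlow hG (fun m => (ω m : E)) (c - s₀))
            ∂Measure.pi (fun _ : Λ => uniformSphere (volume : Measure E))) +
        s₀ * ∫ ω, Real.exp (-(s₀ * esAction κ S₀ U (fun m => ((ω : Λ → sphere (0 : E) 1) m : E)))) *
          H (sphereGradientFlow hG (fun m => (ω m : E)) (c - s₀)) *
            (2 * κ ^ 2 / ((Module.finrank ℝ E : ℝ) - 1) *
              ∑ n, ‖tangentKick (localField U n (fun m => (ω m : E))) ((fun m => (ω m : E)) n)‖ ^ 2)
          ∂Measure.pi (fun _ : Λ => uniformSphere (volume : Measure E)) := by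
    rw [← integral_const_mul, ← integral_const_mul, ← integral_add (hiK.const_mul _) (hiKV.const_mul _)]
    refine integral_congr_ae (ae_of_all _ fun ω => ?_)
    ring
  have hR : ∫ ω, Real.exp (-(s₀ * esAction κ S₀ U (fun m => ((ω : Λ → sphere (0 : E) 1) m : E)))) *
        (-S₀ + s₀ * (2 * κ ^ 2 / ((Module.finrank ℝ E : ℝ) - 1) *
          ∑ n, ‖tangentKick (localField U n (fun m => (ω m : E))) ((fun m => (ω m : E)) n)‖ ^ 2))
        ∂Measure.pi (fun _ : Λ => uniformSphere (volume : Measure E)) =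
      -S₀ * (∫ ω, Real.exp (-(s₀ * esAction κ S₀ U (fun m => ((ω : Λ → sphere (0 : E) 1) m : E))))
          ∂Measure.pi (fun _ : Λ => uniformSphere (volume : Measure E))) +
        s₀ * ∫ ω, Real.exp (-(s₀ * esAction κ S₀ U (fun m => ((ω : Λ → sphere (0 : E) 1) m : E)))) *
          (2 * κ ^ 2 / ((Module.finrank ℝ E : ℝ) - 1) *
            ∑ n, ‖tangentKick (localField U n (fun m => (ω m : E))) ((fun m => (ω m : E)) n)‖ ^ 2)
          ∂Measure.pi (fun _ : Λ => uniformSphere (volume : Measure E)) := by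
    rw [← integral_const_mul, ← integral_const_mul, ← integral_add (hiW.const_mul _) (hiV.const_mul _)]
    refine integral_congr_ae (ae_of_all _ fun ω => ?_)
    ring
  have key : ∀ A B V Z : ℝ, Z ≠ 0 →
      (-S₀ * A + s₀ * B) / Z - A / Z * ((-S₀ * Z + s₀ * V) / Z) = s₀ * (B / Z - A / Z * (V / Z)) := by
    intro A B V Z hZ0
    field_simp
    ring
  rw [hKR, hR]
  exact key _ _ _ _ hZ.ne'

end Transport

end Summit.Ventures.LatticeQCDFlow.Exactness

end
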